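import Literature.InformationTheory.QuantumCodes.CSSEquivalence
import Literature.InformationTheory.QuantumCodes.AbelianTwoBlockParameters
import HarnessLib

/-!
# Equivalences of abelian two-block (and bivariate-bicycle) codes: translations, group
# isomorphisms, block swap, `X ↔ Z` duality; the trivial bound `d ≥ 2`

Lin–Pryadko, *Quantum two-block group algebra codes* [LinPryadko2024, §4.2 Theorem 6] list the
parameter-preserving equivalences of the two-block code `LP[a,b]` (`H_X = [A|B]`, `H_Z = [Bᵀ|Aᵀ]`,
`A = L(a)`, `B = R(b)`); for an ABELIAN group `G` (where `L = R = circulant`, the setting of the tree's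
`AbelianTwoBlock.css a b : CSSCode G G (G ⊕ G)`, coefficient vectors `a b : G → 𝔽₂`) they read:

* (i)  `LP[a,b] ≅ LP[φ a, φ b]` for a group automorphism — here for any additive ISOMORPHISM
  `φ : G ≃+ G'` (the census's (s2) automorphisms and (s0) presentation isomorphisms
  `ℤ_ℓ × ℤ_m ≅ ℤ_gcd × ℤ_lcm`): `css_mapEquiv_dX/dZ/k/isCode_iff`;
* (iv) `LP[a,b] ≅ LP[aα, βb]`, i.e. independent translations of the two coefficient vectors
  (census (s1)): `css_shift_dX/dZ/k/isCode_iff`;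
* (v)  block swap — for abelian `G`, "`L(a) = R(a)`, which also gives `LP[a,b] ≅ LP[b,a]`" (census
  (sw); note it preserves `d_X` and `d_Z` SEPARATELY): `css_swapBlocks_dX/dZ/k/isCode_iff`;
* (vi) the CSS-dual code (interchanged `H_X`, `H_Z`) is `LP[b̂, â]` up to the block swap — here the
  literal identity `css (b ∘ neg) (a ∘ neg) = (css a b).swap` (census (s3)), whence `d_X = d_Z`
  (already `AbelianTwoBlock.css_dX_eq_dZ`).

Each is an instance of permutation equivalence ("FACT P", `CSSEquivalence.lean`) with an EXPLICIT
qubit bijection and explicit check bijections, exactly as in census/SYMMETRIES.md of the qec cell,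
so the enumeration "modulo ⟨s0, s1, s2, sw⟩" of LADDER-QEC grid A rests on kernel theorems. Also:
(w) if both blocks are nonzero every logical operator has weight `≥ 2` (`two_le_hammingNorm_of_zLogical`,
`two_le_dZ`, `two_le_dX`), and the bivariate-bicycle corollaries in polynomial language
(`BB.Code`: multiplying `A` and `B` by independent monomials, transporting along `ℤ_ℓ × ℤ_m ≃+ ℤ_ℓ' × ℤ_m'`
— in particular `x ↔ y` — and exchanging `A ↔ B` preserve `k`, `d^X`, `d^Z`, `d`).
The coset decomposition of imprimitive pairs ([LinPryadko2024, §4.3]; census (s4)) is the separate file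
`TwoBlockCosetDecomposition.lean`. All statements PROVED; no named facts.

## References (locators read on the page)

* [LinPryadko2024] H.-K. Lin, L. P. Pryadko, PRA 109 (2024) 022407 = arXiv:2306.16400: §4.2 Thm 6
  (held text chunk p0009 L66–98: items (i)–(vi) and "with an abelian group G, for any a ∈ F[G],
  L(a) = R(a), which also gives LP[a,b] ≅ LP[b,a], and an immediate consequence, d_X = d_Z");
  App. proof of Thm 6 (chunk p0018 L3–50: (i) `S H_X (u;v) = (SAS⁻¹,SBS⁻¹)(Su;Sv)`; (iv) `A' = AL`,
  `B' = BR`, "a consequence of commutativity of left and right matrices"; (v) "interchange the blocks").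
* [BravyiEtAl2024] S. Bravyi et al., Nature 627 (2024) 778 = arXiv:2308.07915: SI §9.2 (chunk p0021
  L60–62, p0022 L8: translations `α ↦ α A_j A_kᵀ` are automorphisms — "the same as permuting the X
  checks"), SI §9.3 (chunk p0022 L14–20: the ZX-duality `q(L,α) ↔ q(R,αᵀ)` "switches the stabilizer
  implemented by q(X,β) with the stabilizer implemented by q(Z,βᵀ)"), §4 (p0009 L23–35: `A`, `B` sums of
  monomials `xⁱyʲ`, `H^X = [A|B]`, `H^Z = [Bᵀ|Aᵀ]`).
-/

namespace Literature.InformationTheory.QuantumCodes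

open Matrix

namespace AbelianTwoBlock

variable {G : Type*} [Fintype G] [AddCommGroup G]

/-! ### Entries of the check matrices -/

omit [Fintype G] in
/-- `H_X g (L h) = a(g − h)`. [cite: LinPryadko2024, §3 eq. (10) `H_X = (A, B)` (arXiv:2306.16400)] -/
@[simp] theorem HX_apply_inl (a b : G → ZMod 2) (g h : G) : HX a b g (Sum.inl h) = a (g - h) := by
  simp [HX]

omit [Fintype G] in
/-- `H_X g (R h) = b(g − h)`. [cite: LinPryadko2024, §3 eq. (10) `H_X = (A, B)` (arXiv:2306.16400)] -/
@[simp] theorem HX_apply_inr (a b : G → ZMod 2) (g h : G) : HX a b g (Sum.inr h) = b (g - h) := by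
  simp [HX]

omit [Fintype G] in
/-- `H_Z g (L h) = b(h − g)`. [cite: LinPryadko2024, §3 eq. (10) `H_Z = (Bᵀ, −Aᵀ)` (arXiv:2306.16400)] -/
@[simp] theorem HZ_apply_inl (a b : G → ZMod 2) (g h : G) : HZ a b g (Sum.inl h) = b (h - g) := by
  simp [HZ]

omit [Fintype G] in
/-- `H_Z g (R h) = a(h − g)`. [cite: LinPryadko2024, §3 eq. (10) `H_Z = (Bᵀ, −Aᵀ)` (arXiv:2306.16400)] -/
@[simp] theorem HZ_apply_inr (a b : G → ZMod 2) (g h : G) : HZ a b g (Sum.inr h) = a (h - g) := by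
  simp [HZ]

/-! ### (s1) Independent translations of the two blocks — Lin–Pryadko Thm 6 (iv) -/

/-- The translate `a(· − u)` of a coefficient vector (in group-algebra terms: `a · α` with `α` the group
element `u`). [cite: LinPryadko2024, §4.2 Thm 6(iv) `LP[aα, βb]` (arXiv:2306.16400 chunk p0009 L84)] -/
def shift (u : G) (a : G → ZMod 2) : G → ZMod 2 := fun g => a (g - u)

omit [Fintype G] in
/-- `shift u a g = a (g - u)`. [cite: LinPryadko2024, §4.2 Thm 6(iv) (arXiv:2306.16400 chunk p0009 L84)] -/
@[simp] theorem shift_apply (u : G) (a : G → ZMod 2) (g : G) : shift u a g = a (g - u) := rfl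

/-- The qubit permutation realising (s1): left qubit `h ↦ h + u`, right qubit `h ↦ h + v`.
[cite: LinPryadko2024, App. proof of Thm 6(iv) "u → Lᵀu, v → Rᵀv" (arXiv:2306.16400 chunk p0018 L26–32)] -/
def shiftPerm (u v : G) : G ⊕ G ≃ G ⊕ G := Equiv.sumCongr (Equiv.addRight u) (Equiv.addRight v)

omit [Fintype G] in
/-- `H_X` of the translated pair is `H_X` with the qubits permuted by `shiftPerm u v` (checks fixed).
[cite: LinPryadko2024, App. proof of Thm 6(iv) "A' = AL, B' = BR" (arXiv:2306.16400 chunk p0018 L26–32)] -/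
theorem HX_shift (a b : G → ZMod 2) (u v : G) :
    HX (shift u a) (shift v b) = (HX a b).submatrix (Equiv.refl G) (shiftPerm u v) := by
  ext i (j | j)
  · simp [shiftPerm, sub_sub]
  · simp [shiftPerm, sub_sub]

omit [Fintype G] in
/-- `H_Z` of the translated pair is `H_Z` with the qubits permuted by `shiftPerm u v` and the checks by
`g ↦ g + (u + v)` (census (s1): "Z-check g ↦ Z-check g − u − v").
[cite: LinPryadko2024, App. proof of Thm 6(iv) (arXiv:2306.16400 chunk p0018 L26–38)] -/
theorem HZ_shift (a b : G → ZMod 2) (u v : G) :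
    HZ (shift u a) (shift v b) = (HZ a b).submatrix (Equiv.addRight (u + v)) (shiftPerm u v) := by
  ext i (j | j)
  · simp only [HZ_apply_inl, shift_apply, submatrix_apply, Equiv.coe_addRight, shiftPerm,
      Equiv.sumCongr_apply, Sum.map_inl]
    congr 1; abel
  · simp only [HZ_apply_inr, shift_apply, submatrix_apply, Equiv.coe_addRight, shiftPerm,
      Equiv.sumCongr_apply, Sum.map_inr]
    congr 1; abel

/-- **(s1) translations preserve `d^X`**: `d^X(css a(·−u) b(·−v)) = d^X(css a b)`.
[cite: LinPryadko2024, §4.2 Thm 6(iv) (arXiv:2306.16400 chunk p0009 L84)] -/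
theorem css_shift_dX (a b : G → ZMod 2) (u v : G) : (css (shift u a) (shift v b)).dX = (css a b).dX :=
  CSSCode.dX_eq_of_submatrix (C := css a b) (C' := css (shift u a) (shift v b)) (HX_shift a b u v)
    (HZ_shift a b u v)

/-- **(s1) translations preserve `d^Z`**. [cite: LinPryadko2024, §4.2 Thm 6(iv) (arXiv:2306.16400 chunk p0009 L84)] -/
theorem css_shift_dZ (a b : G → ZMod 2) (u v : G) : (css (shift u a) (shift v b)).dZ = (css a b).dZ :=
  CSSCode.dZ_eq_of_submatrix (C := css a b) (C' := css (shift u a) (shift v b)) (HX_shift a b u v)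
    (HZ_shift a b u v)

/-- **(s1) translations preserve `k`**. [cite: LinPryadko2024, §4.2 Thm 6(iv) (arXiv:2306.16400 chunk p0009 L84)] -/
theorem css_shift_k (a b : G → ZMod 2) (u v : G) : (css (shift u a) (shift v b)).k = (css a b).k :=
  CSSCode.k_eq_of_submatrix (C := css a b) (C' := css (shift u a) (shift v b)) (HX_shift a b u v)
    (HZ_shift a b u v)

/-- **(s1) translations preserve the census parameters `[[n,k,d]]`**.
[cite: LinPryadko2024, §4.2 Thm 6(iv) (arXiv:2306.16400 chunk p0009 L84)] -/
theorem css_shift_isCode_iff [DecidableEq G] (a b : G → ZMod 2) (u v : G) (n k d : ℕ) :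
    (css (shift u a) (shift v b)).IsCode n k d ↔ (css a b).IsCode n k d :=
  CSSCode.isCode_iff_of_submatrix (C := css a b) (C' := css (shift u a) (shift v b)) (HX_shift a b u v)
    (HZ_shift a b u v) n k d

/-! ### (s2)/(s0) Transport along an additive isomorphism `φ : G ≃+ G'` — Lin–Pryadko Thm 6 (i) -/

section MapEquiv

variable {G' : Type*} [Fintype G'] [AddCommGroup G']

omit [Fintype G] [Fintype G'] in
/-- `H_X` of the transported pair `(a ∘ φ⁻¹, b ∘ φ⁻¹)` over `G'` is `H_X(a,b)` re-indexed by `φ⁻¹` on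
checks and on both qubit blocks. [cite: LinPryadko2024, App. proof of Thm 6(i) "S H_X (u;v) = (SAS⁻¹, SBS⁻¹)(Su;Sv)" (arXiv:2306.16400 chunk p0018 L3–14)] -/
theorem HX_mapEquiv (a b : G → ZMod 2) (φ : G ≃+ G') :
    HX (a ∘ φ.symm) (b ∘ φ.symm) =
      (HX a b).submatrix φ.symm.toEquiv (Equiv.sumCongr φ.symm.toEquiv φ.symm.toEquiv) := by
  ext i (j | j)
  · simp
  · simp

omit [Fintype G] [Fintype G'] in
/-- `H_Z` of the transported pair is `H_Z(a,b)` re-indexed likewise.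
[cite: LinPryadko2024, App. proof of Thm 6(i) "and similarly for H_Z" (arXiv:2306.16400 chunk p0018 L3–14)] -/
theorem HZ_mapEquiv (a b : G → ZMod 2) (φ : G ≃+ G') :
    HZ (a ∘ φ.symm) (b ∘ φ.symm) =
      (HZ a b).submatrix φ.symm.toEquiv (Equiv.sumCongr φ.symm.toEquiv φ.symm.toEquiv) := by
  ext i (j | j)
  · simp
  · simp

/-- **(s2)/(s0) group isomorphisms preserve `d^X`**: for `φ : G ≃+ G'`,
`d^X(css (a∘φ⁻¹) (b∘φ⁻¹)) = d^X(css a b)` — automorphisms of `G` (s2) and presentation isomorphisms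
such as `ℤ_ℓ × ℤ_m ≅ ℤ_{gcd} × ℤ_{lcm}` or `x ↔ y` (s0) alike.
[cite: LinPryadko2024, §4.2 Thm 6(i) "LP[φ(a),φ(b)], for any automorphism φ" (arXiv:2306.16400 chunk p0009 L76–78)] -/
theorem css_mapEquiv_dX (a b : G → ZMod 2) (φ : G ≃+ G') :
    (css (a ∘ φ.symm) (b ∘ φ.symm)).dX = (css a b).dX :=
  CSSCode.dX_eq_of_submatrix (C := css a b) (C' := css (a ∘ φ.symm) (b ∘ φ.symm)) (HX_mapEquiv a b φ)
    (HZ_mapEquiv a b φ)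

/-- **(s2)/(s0) group isomorphisms preserve `d^Z`**. [cite: LinPryadko2024, §4.2 Thm 6(i) (arXiv:2306.16400 chunk p0009 L76–78)] -/
theorem css_mapEquiv_dZ (a b : G → ZMod 2) (φ : G ≃+ G') :
    (css (a ∘ φ.symm) (b ∘ φ.symm)).dZ = (css a b).dZ :=
  CSSCode.dZ_eq_of_submatrix (C := css a b) (C' := css (a ∘ φ.symm) (b ∘ φ.symm)) (HX_mapEquiv a b φ)
    (HZ_mapEquiv a b φ)

/-- **(s2)/(s0) group isomorphisms preserve `k`**. [cite: LinPryadko2024, §4.2 Thm 6(i) (arXiv:2306.16400 chunk p0009 L76–78)] -/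
theorem css_mapEquiv_k (a b : G → ZMod 2) (φ : G ≃+ G') :
    (css (a ∘ φ.symm) (b ∘ φ.symm)).k = (css a b).k :=
  CSSCode.k_eq_of_submatrix (C := css a b) (C' := css (a ∘ φ.symm) (b ∘ φ.symm)) (HX_mapEquiv a b φ)
    (HZ_mapEquiv a b φ)

/-- **(s2)/(s0) group isomorphisms preserve `[[n,k,d]]`**. [cite: LinPryadko2024, §4.2 Thm 6(i) (arXiv:2306.16400 chunk p0009 L76–78)] -/
theorem css_mapEquiv_isCode_iff [DecidableEq G] [DecidableEq G'] (a b : G → ZMod 2) (φ : G ≃+ G')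
    (n k d : ℕ) :
    (css (a ∘ φ.symm) (b ∘ φ.symm)).IsCode n k d ↔ (css a b).IsCode n k d :=
  CSSCode.isCode_iff_of_submatrix (C := css a b) (C' := css (a ∘ φ.symm) (b ∘ φ.symm))
    (HX_mapEquiv a b φ) (HZ_mapEquiv a b φ) n k d

end MapEquiv

/-! ### (sw) Block swap `(a, b) ↦ (b, a)` — Lin–Pryadko Thm 6 (v), abelian case -/

omit [Fintype G] in
/-- `H_X(b,a) = [B|A]` is `H_X(a,b)` with the two qubit blocks exchanged.
[cite: LinPryadko2024, §4.2 after Thm 6 "with an abelian group G … L(a) = R(a), which also gives LP[a,b] ≅ LP[b,a]" (arXiv:2306.16400 chunk p0009 L95–97)] -/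
theorem HX_swapBlocks (a b : G → ZMod 2) :
    HX b a = (HX a b).submatrix (Equiv.refl G) (Equiv.sumComm G G) := by
  ext i (j | j)
  · simp
  · simp

omit [Fintype G] in
/-- `H_Z(b,a) = [Aᵀ|Bᵀ]` is `H_Z(a,b)` with the two qubit blocks exchanged.
[cite: LinPryadko2024, §4.2 after Thm 6 (arXiv:2306.16400 chunk p0009 L95–97)] -/
theorem HZ_swapBlocks (a b : G → ZMod 2) :
    HZ b a = (HZ a b).submatrix (Equiv.refl G) (Equiv.sumComm G G) := by
  ext i (j | j)
  · simp
  · simp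

/-- **(sw) the block swap preserves `d^X`** (NB: `d^X ↦ d^X`, not `d^Z` — the permutation `L_g ↔ R_g`
maps `X`-checks to `X`-checks). [cite: LinPryadko2024, §4.2 Thm 6(v) and the abelian remark (arXiv:2306.16400 chunk p0009 L86, L95–97)] -/
theorem css_swapBlocks_dX (a b : G → ZMod 2) : (css b a).dX = (css a b).dX :=
  CSSCode.dX_eq_of_submatrix (C := css a b) (C' := css b a) (HX_swapBlocks a b) (HZ_swapBlocks a b)

/-- **(sw) the block swap preserves `d^Z`**. [cite: LinPryadko2024, §4.2 Thm 6(v) and the abelian remark (arXiv:2306.16400 chunk p0009 L86, L95–97)] -/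
theorem css_swapBlocks_dZ (a b : G → ZMod 2) : (css b a).dZ = (css a b).dZ :=
  CSSCode.dZ_eq_of_submatrix (C := css a b) (C' := css b a) (HX_swapBlocks a b) (HZ_swapBlocks a b)

/-- **(sw) the block swap preserves `k`**. [cite: LinPryadko2024, §4.2 Thm 6(v) and the abelian remark (arXiv:2306.16400 chunk p0009 L86, L95–97)] -/
theorem css_swapBlocks_k (a b : G → ZMod 2) : (css b a).k = (css a b).k :=
  CSSCode.k_eq_of_submatrix (C := css a b) (C' := css b a) (HX_swapBlocks a b) (HZ_swapBlocks a b)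

/-- **(sw) the block swap preserves `[[n,k,d]]`**. [cite: LinPryadko2024, §4.2 Thm 6(v) and the abelian remark (arXiv:2306.16400 chunk p0009 L86, L95–97)] -/
theorem css_swapBlocks_isCode_iff [DecidableEq G] (a b : G → ZMod 2) (n k d : ℕ) :
    (css b a).IsCode n k d ↔ (css a b).IsCode n k d :=
  CSSCode.isCode_iff_of_submatrix (C := css a b) (C' := css b a) (HX_swapBlocks a b)
    (HZ_swapBlocks a b) n k d

/-! ### (s3) The `X ↔ Z` duality as a literal identity — Lin–Pryadko Thm 6 (vi) -/

omit [Fintype G] in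
/-- `H_X(b(−·), a(−·)) = H_Z(a,b)`: the antipode-and-swap pair has the `Z`-checks of `(a,b)` as its
`X`-checks ("the code CSS-dual to LP[a,b], with interchanged H_X and H_Z matrices, is … LP[â, −b̂]";
census (s3): `H_X(A*,B*) = H_Z(A,B)` with `A* = −B`, `B* = −A`).
[cite: LinPryadko2024, §4.2 Thm 6(vi) (arXiv:2306.16400 chunk p0009 L88–91)] -/
theorem HX_dual (a b : G → ZMod 2) : HX (fun g => b (-g)) (fun g => a (-g)) = HZ a b := by
  ext i (j | j)
  · simp [neg_sub]
  · simp [neg_sub]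

omit [Fintype G] in
/-- `H_Z(b(−·), a(−·)) = H_X(a,b)`. [cite: LinPryadko2024, §4.2 Thm 6(vi) (arXiv:2306.16400 chunk p0009 L88–91)] -/
theorem HZ_dual (a b : G → ZMod 2) : HZ (fun g => b (-g)) (fun g => a (-g)) = HX a b := by
  ext i (j | j)
  · simp [neg_sub]
  · simp [neg_sub]

/-- **(s3) the `X ↔ Z` duality is realised INSIDE the family**: the two-block code on the pair
`(b(−·), a(−·))` is literally the `X ↔ Z` exchange (`CSSCode.swap`) of the code on `(a,b)`.
[cite: LinPryadko2024, §4.2 Thm 6(vi) (arXiv:2306.16400 chunk p0009 L88–91)]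
[cite: BravyiEtAl2024, SI §9.3 "this permutation switches the stabilizer implemented by q(X,β) with the stabilizer implemented by q(Z,βᵀ), so this permutation is indeed a ZX-duality" (arXiv:2308.07915 chunk p0022 L18–20)] -/
theorem css_dual_eq_swap (a b : G → ZMod 2) : css (fun g => b (-g)) (fun g => a (-g)) = (css a b).swap := by
  have hX := HX_dual a b
  have hZ := HZ_dual a b
  unfold css CSSCode.swap
  simp only [hX, hZ]

/-- Hence `d^X` of the dual pair is `d^Z` of the original (and vice versa).
[cite: LinPryadko2024, §4.2 Thm 6(vi) (arXiv:2306.16400 chunk p0009 L88–91)] -/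
theorem css_dual_dX (a b : G → ZMod 2) : (css (fun g => b (-g)) (fun g => a (-g))).dX = (css a b).dZ := by
  rw [css_dual_eq_swap]; rfl

/-- `d^Z` of the dual pair is `d^X` of the original. [cite: LinPryadko2024, §4.2 Thm 6(vi) (arXiv:2306.16400 chunk p0009 L88–91)] -/
theorem css_dual_dZ (a b : G → ZMod 2) : (css (fun g => b (-g)) (fun g => a (-g))).dZ = (css a b).dX := by
  rw [css_dual_eq_swap, CSSCode.dZ_swap]

/-- `k` of the dual pair is `k` of the original. [cite: LinPryadko2024, §4.2 Thm 6(vi) (arXiv:2306.16400 chunk p0009 L88–91)] -/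
theorem css_dual_k (a b : G → ZMod 2) : (css (fun g => b (-g)) (fun g => a (-g))).k = (css a b).k := by
  rw [css_dual_eq_swap, CSSCode.k_swap]

/-- The census's derivation of LEMMA XZ, as stated in SYMMETRIES.md (s3): the dual pair is the block
swap of the transport along the automorphism `φ = −id`, so by (sw) and (s2) its `d^X` equals
`d^X(a,b)`; combined with `css_dual_dX` this is `d^X = d^Z` (the tree's `css_dX_eq_dZ`, recovered).
[cite: LinPryadko2024, §4.2 after Thm 6 "an immediate consequence, d_X = d_Z" (arXiv:2306.16400 chunk p0009 L97)] -/
theorem css_dX_eq_dZ' (a b : G → ZMod 2) : (css a b).dX = (css a b).dZ := by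
  have h1 : (css (fun g => a (-g)) (fun g => b (-g))).dX = (css a b).dX :=
    css_mapEquiv_dX a b (AddEquiv.neg G)
  have h2 : (css (fun g => b (-g)) (fun g => a (-g))).dX = (css (fun g => a (-g)) (fun g => b (-g))).dX :=
    css_swapBlocks_dX _ _
  rw [← css_dual_dX, h2, h1]

/-! ### (w) Both blocks nonzero ⇒ every logical operator has weight ≥ 2 -/

/-- A column of `H_X` is nonzero when its block's coefficient vector is: `H_X e_{L h} ≠ 0` if `a ≠ 0`,
`H_X e_{R h} ≠ 0` if `b ≠ 0` (each qubit meets `|supp a|` resp. `|supp b|` `X`-checks).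
[cite: LinPryadko2024, §3 eq. (10) (arXiv:2306.16400)] -/
theorem HX_mulVec_single_ne_zero [DecidableEq G] {a b : G → ZMod 2} (ha : a ≠ 0) (hb : b ≠ 0)
    (q : G ⊕ G) : HX a b *ᵥ Pi.single q 1 ≠ 0 := by
  intro h0
  rcases q with h | h
  · obtain ⟨s, hs⟩ := Function.ne_iff.1 ha
    have := congr_fun h0 (h + s)
    simp at this
    exact hs (by simpa using this)
  · obtain ⟨s, hs⟩ := Function.ne_iff.1 hb
    have := congr_fun h0 (h + s)
    simp at this
    exact hs (by simpa using this)

/-- Dually `H_Z e_q ≠ 0` for every qubit `q` when `a ≠ 0` and `b ≠ 0`.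
[cite: LinPryadko2024, §3 eq. (10) (arXiv:2306.16400)] -/
theorem HZ_mulVec_single_ne_zero [DecidableEq G] {a b : G → ZMod 2} (ha : a ≠ 0) (hb : b ≠ 0)
    (q : G ⊕ G) : HZ a b *ᵥ Pi.single q 1 ≠ 0 := by
  rw [← HX_dual]
  exact HX_mulVec_single_ne_zero (a := fun g => b (-g)) (b := fun g => a (-g))
    (fun h => hb (by funext g; simpa using congr_fun h (-g)))
    (fun h => ha (by funext g; simpa using congr_fun h (-g))) q

/-- Over `𝔽₂` a vector of Hamming weight `1` is a basis vector `e_q`. [folklore] -/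
private theorem eq_single_of_hammingNorm_eq_one {ι : Type*} [Fintype ι] [DecidableEq ι] {v : ι → ZMod 2}
    (hv : hammingNorm v = 1) : ∃ q, v = Pi.single q 1 := by
  unfold hammingNorm at hv
  obtain ⟨q, hq⟩ := Finset.card_eq_one.1 hv
  refine ⟨q, funext fun i => ?_⟩
  have hmem : ∀ i, v i ≠ 0 ↔ i = q := fun i => by
    simpa using Finset.ext_iff.1 hq i
  have h01 : ∀ x : ZMod 2, x ≠ 0 → x = 1 := by decide
  by_cases hi : i = q
  · subst hi
    simp [h01 _ ((hmem i).2 rfl)]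
  · have : v i = 0 := by
      by_contra h; exact hi ((hmem i).1 h)
    simp [this, hi]

/-- **(w), `Z` side**: if `a ≠ 0` and `b ≠ 0`, every `Z`-type logical operator (`H_X v = 0`,
`v ∉ rs H_Z`) has weight `≥ 2` — a weight-1 `Z` anticommutes with the `X`-checks through its qubit.
[cite: LinPryadko2024, §5 (distance bounds for 2BGA codes) (arXiv:2306.16400)] -/
theorem two_le_hammingNorm_of_zLogical [DecidableEq G] {a b : G → ZMod 2} (ha : a ≠ 0) (hb : b ≠ 0) (v : G ⊕ G → ZMod 2)
    (hv : HX a b *ᵥ v = 0) (hv' : v ∉ rowSpace (HZ a b)) : 2 ≤ hammingNorm v := by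
  have hne : v ≠ 0 := by
    rintro rfl; exact hv' (Submodule.zero_mem _)
  have hpos : 0 < hammingNorm v := hammingNorm_pos_iff.2 hne
  by_contra hlt
  have h1 : hammingNorm v = 1 := by omega
  obtain ⟨q, rfl⟩ := eq_single_of_hammingNorm_eq_one h1
  exact HX_mulVec_single_ne_zero ha hb q hv

/-- **(w), `X` side**: if `a ≠ 0` and `b ≠ 0`, every `X`-type logical operator (`H_Z v = 0`,
`v ∉ rs H_X`) has weight `≥ 2`. [cite: LinPryadko2024, §5 (distance bounds for 2BGA codes) (arXiv:2306.16400)] -/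
theorem two_le_hammingNorm_of_xLogical [DecidableEq G] {a b : G → ZMod 2} (ha : a ≠ 0) (hb : b ≠ 0) (v : G ⊕ G → ZMod 2)
    (hv : HZ a b *ᵥ v = 0) (hv' : v ∉ rowSpace (HX a b)) : 2 ≤ hammingNorm v := by
  have hne : v ≠ 0 := by
    rintro rfl; exact hv' (Submodule.zero_mem _)
  have hpos : 0 < hammingNorm v := hammingNorm_pos_iff.2 hne
  by_contra hlt
  have h1 : hammingNorm v = 1 := by omega
  obtain ⟨q, rfl⟩ := eq_single_of_hammingNorm_eq_one h1
  exact HZ_mulVec_single_ne_zero ha hb q hv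

/-- **(w) `d^Z ≥ 2`** for a two-block code with both blocks nonzero and `k > 0` (census: an `(n,k)` group
whose best upper bound is `2` is settled by its witnesses alone).
[cite: LinPryadko2024, §5 (distance bounds for 2BGA codes) (arXiv:2306.16400)] -/
theorem two_le_dZ [DecidableEq G] {a b : G → ZMod 2} (ha : a ≠ 0) (hb : b ≠ 0) (hk : 0 < (css a b).k) :
    2 ≤ (css a b).dZ :=
  (css a b).le_dZ ((css a b).dZ_pos_iff.1 ((css a b).dZ_pos_of_k_pos hk))
    (fun v hv hv' => two_le_hammingNorm_of_zLogical ha hb v hv hv')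

/-- **(w) `d^X ≥ 2`** likewise. [cite: LinPryadko2024, §5 (distance bounds for 2BGA codes) (arXiv:2306.16400)] -/
theorem two_le_dX [DecidableEq G] {a b : G → ZMod 2} (ha : a ≠ 0) (hb : b ≠ 0) (hk : 0 < (css a b).k) :
    2 ≤ (css a b).dX :=
  (css a b).le_dX ((css a b).dX_pos_iff.1 ((css a b).dX_pos_of_k_pos hk))
    (fun v hv hv' => two_le_hammingNorm_of_xLogical ha hb v hv hv')

end AbelianTwoBlock

/-! ### Bivariate-bicycle corollaries (`G = ℤ_ℓ × ℤ_m`, polynomial language of [BravyiEtAl2024, §4]) -/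

namespace BB

/-- The `x ↔ y` relabelling of exponents (`ℓ = m`), as the additive automorphism `(i, j) ↦ (j, i)` of
`ℤ_ℓ × ℤ_ℓ`; `QC(A, B)` with `x` and `y` exchanged is `C.mapEquiv swapXY`, so `Code.mapEquiv_dX/dZ/k/d`
apply (census (s0): "includes the x↔y relabelling (ℓ,m) ↦ (m,ℓ)").
[cite: LinPryadko2024, §4.2 Thm 6(i) (arXiv:2306.16400 chunk p0009 L76–78)] -/
def swapXY (ℓ : ℕ) [NeZero ℓ] : Mono ℓ ℓ ≃+ Mono ℓ ℓ := AddEquiv.prodComm (M := Fin ℓ) (N := Fin ℓ)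

/-- `swapXY` exchanges the two exponents. [cite: LinPryadko2024, §4.2 Thm 6(i) (arXiv:2306.16400 chunk p0009 L76–78)] -/
@[simp] theorem swapXY_apply {ℓ : ℕ} [NeZero ℓ] (g : Mono ℓ ℓ) : swapXY ℓ g = g.swap := rfl


variable {ℓ m : ℕ} [NeZero ℓ] [NeZero m]

omit [NeZero ℓ] [NeZero m] in
/-- Multiplication of `p ∈ 𝔽₂[x,y]/(xˡ−1, yᵐ−1)` by the monomial `x^{t.1} y^{t.2}`: on coefficient
functions, `(t · p)(g) = p(g − t)`. [cite: BravyiEtAl2024, §4 "A and B commute: every monomial is a permutation" (arXiv:2308.07915 chunk p0009 L23–27)] -/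
def mulMonomial (t : Mono ℓ m) (p : Poly ℓ m) : Poly ℓ m := fun g => p (g - t)

omit [NeZero ℓ] [NeZero m] in
/-- `mulMonomial t p g = p (g - t)`. [cite: BravyiEtAl2024, §4 (arXiv:2308.07915 chunk p0009 L23–27)] -/
@[simp] theorem mulMonomial_apply (t : Mono ℓ m) (p : Poly ℓ m) (g : Mono ℓ m) :
    mulMonomial t p g = p (g - t) := rfl

/-- FAITHFULNESS: the matrix of `t · p` is the product of the matrix of the monomial `t` with the matrix
of `p` (`toMatrix` turns group-algebra products into matrix products), so `mulMonomial` IS multiplication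
by `xⁱyʲ` in the paper's matrix picture.
[cite: BravyiEtAl2024, §4 "x = S_ℓ ⊗ I_m, y = I_ℓ ⊗ S_m … A = A₁ + A₂ + A₃ where each Aᵢ is a power of x or y" (arXiv:2308.07915 chunk p0009 L16–27)] -/
theorem toMatrix_mulMonomial (t : Mono ℓ m) (p : Poly ℓ m) :
    toMatrix (mulMonomial t p) = toMatrix (monomial t.1 t.2) * toMatrix p := by
  ext i j
  rw [toMatrix_apply, Matrix.mul_apply]
  rw [Finset.sum_eq_single (i + t)]
  · have hmono : monomial t.1 t.2 t = 1 := by simp [monomial]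
    simp [toMatrix_apply, sub_sub, add_comm, hmono]
  · intro h _ hne
    rw [toMatrix_monomial_apply, if_neg (by simpa using hne), zero_mul]
  · intro h; exact absurd (Finset.mem_univ _) h

/-- On coefficient vectors, multiplying by the monomial `t` is the translation by `−t`.
[cite: BravyiEtAl2024, §4 (arXiv:2308.07915 chunk p0009 L23–27)] -/
theorem coeffVec_mulMonomial (t : Mono ℓ m) (p : Poly ℓ m) :
    coeffVec (mulMonomial t p) = AbelianTwoBlock.shift (-t) (coeffVec p) := by
  funext g
  simp only [coeffVec_apply, mulMonomial_apply, AbelianTwoBlock.shift_apply, sub_neg_eq_add]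
  congr 1; abel

namespace Code

variable (C : Code ℓ m)

/-- **(s1) for BB codes**: replacing `(A, B)` by `(xⁱyʲ A, xⁱ'yʲ' B)` (independent monomial factors)
preserves `d^X`. [cite: LinPryadko2024, §4.2 Thm 6(iv) (arXiv:2306.16400 chunk p0009 L84)] -/
theorem mulMonomial_dX (s t : Mono ℓ m) :
    (Code.mk (mulMonomial s C.A) (mulMonomial t C.B)).css.dX = C.css.dX := by
  rw [css_eq, css_eq, coeffVec_mulMonomial, coeffVec_mulMonomial, AbelianTwoBlock.css_shift_dX]

/-- (s1) for BB codes, `d^Z`. [cite: LinPryadko2024, §4.2 Thm 6(iv) (arXiv:2306.16400 chunk p0009 L84)] -/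
theorem mulMonomial_dZ (s t : Mono ℓ m) :
    (Code.mk (mulMonomial s C.A) (mulMonomial t C.B)).css.dZ = C.css.dZ := by
  rw [css_eq, css_eq, coeffVec_mulMonomial, coeffVec_mulMonomial, AbelianTwoBlock.css_shift_dZ]

/-- (s1) for BB codes, `k`. [cite: LinPryadko2024, §4.2 Thm 6(iv) (arXiv:2306.16400 chunk p0009 L84)] -/
theorem mulMonomial_k (s t : Mono ℓ m) :
    (Code.mk (mulMonomial s C.A) (mulMonomial t C.B)).k = C.k := by
  rw [k, k, css_eq, css_eq, coeffVec_mulMonomial, coeffVec_mulMonomial, AbelianTwoBlock.css_shift_k]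

/-- (s1) for BB codes, `d = min(d^X, d^Z)`. [cite: LinPryadko2024, §4.2 Thm 6(iv) (arXiv:2306.16400 chunk p0009 L84)] -/
theorem mulMonomial_d (s t : Mono ℓ m) :
    (Code.mk (mulMonomial s C.A) (mulMonomial t C.B)).d = C.d := by
  rw [d, d, mulMonomial_dX, mulMonomial_dZ]

/-- **(sw) for BB codes**: `QC(B, A)` has the `d^X` of `QC(A, B)`.
[cite: LinPryadko2024, §4.2 Thm 6(v) and abelian remark (arXiv:2306.16400 chunk p0009 L86, L95–97)] -/
theorem swapBlocks_dX : (Code.mk C.B C.A).css.dX = C.css.dX := by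
  rw [css_eq, css_eq, AbelianTwoBlock.css_swapBlocks_dX]

/-- (sw) for BB codes, `d^Z`. [cite: LinPryadko2024, §4.2 Thm 6(v) (arXiv:2306.16400 chunk p0009 L86, L95–97)] -/
theorem swapBlocks_dZ : (Code.mk C.B C.A).css.dZ = C.css.dZ := by
  rw [css_eq, css_eq, AbelianTwoBlock.css_swapBlocks_dZ]

/-- (sw) for BB codes, `k`. [cite: LinPryadko2024, §4.2 Thm 6(v) (arXiv:2306.16400 chunk p0009 L86, L95–97)] -/
theorem swapBlocks_k : (Code.mk C.B C.A).k = C.k := by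
  rw [k, k, css_eq, css_eq, AbelianTwoBlock.css_swapBlocks_k]

/-- (sw) for BB codes, `d`. [cite: LinPryadko2024, §4.2 Thm 6(v) (arXiv:2306.16400 chunk p0009 L86, L95–97)] -/
theorem swapBlocks_d : (Code.mk C.B C.A).d = C.d := by
  rw [d, d, swapBlocks_dX, swapBlocks_dZ]

end Code

/-! #### (s2)/(s0) for BB codes: transport along `ℤ_ℓ × ℤ_m ≃+ ℤ_ℓ' × ℤ_m'` (in particular `x ↔ y`) -/

namespace Code

variable {ℓ' m' : ℕ} [NeZero ℓ'] [NeZero m'] (C : Code ℓ m)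

/-- The code transported along an additive isomorphism of the monomial groups
`φ : ℤ_ℓ × ℤ_m ≃+ ℤ_ℓ' × ℤ_m'` (apply `φ` to every exponent of `A` and of `B`).
[cite: LinPryadko2024, §4.2 Thm 6(i) (arXiv:2306.16400 chunk p0009 L76–78)] -/
def mapEquiv (φ : Mono ℓ m ≃+ Mono ℓ' m') : Code ℓ' m' := ⟨C.A ∘ φ.symm, C.B ∘ φ.symm⟩

/-- Coefficient vectors transport along `φ` (negation commutes with `φ`).
[cite: LinPryadko2024, §4.2 Thm 6(i) (arXiv:2306.16400 chunk p0009 L76–78)] -/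
theorem coeffVec_comp_symm (p : Poly ℓ m) (φ : Mono ℓ m ≃+ Mono ℓ' m') :
    coeffVec (p ∘ φ.symm) = coeffVec p ∘ φ.symm := by
  funext g; simp only [coeffVec_apply, Function.comp_apply, map_neg]

/-- **(s2)/(s0) for BB codes, `d^X`**. [cite: LinPryadko2024, §4.2 Thm 6(i) (arXiv:2306.16400 chunk p0009 L76–78)] -/
theorem mapEquiv_dX (φ : Mono ℓ m ≃+ Mono ℓ' m') : (C.mapEquiv φ).css.dX = C.css.dX := by
  rw [css_eq, css_eq, mapEquiv, coeffVec_comp_symm, coeffVec_comp_symm, AbelianTwoBlock.css_mapEquiv_dX]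

/-- (s2)/(s0) for BB codes, `d^Z`. [cite: LinPryadko2024, §4.2 Thm 6(i) (arXiv:2306.16400 chunk p0009 L76–78)] -/
theorem mapEquiv_dZ (φ : Mono ℓ m ≃+ Mono ℓ' m') : (C.mapEquiv φ).css.dZ = C.css.dZ := by
  rw [css_eq, css_eq, mapEquiv, coeffVec_comp_symm, coeffVec_comp_symm, AbelianTwoBlock.css_mapEquiv_dZ]

/-- (s2)/(s0) for BB codes, `k`. [cite: LinPryadko2024, §4.2 Thm 6(i) (arXiv:2306.16400 chunk p0009 L76–78)] -/
theorem mapEquiv_k (φ : Mono ℓ m ≃+ Mono ℓ' m') : (C.mapEquiv φ).k = C.k := by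
  rw [k, k, css_eq, css_eq, mapEquiv, coeffVec_comp_symm, coeffVec_comp_symm,
    AbelianTwoBlock.css_mapEquiv_k]

/-- (s2)/(s0) for BB codes, `d`. [cite: LinPryadko2024, §4.2 Thm 6(i) (arXiv:2306.16400 chunk p0009 L76–78)] -/
theorem mapEquiv_d (φ : Mono ℓ m ≃+ Mono ℓ' m') : (C.mapEquiv φ).d = C.d := by
  rw [d, d, mapEquiv_dX, mapEquiv_dZ]

omit [NeZero ℓ] [NeZero m] [NeZero ℓ'] [NeZero m'] in
/-- `n` is preserved as well (an isomorphism forces `ℓm = ℓ'm'`).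
[cite: LinPryadko2024, §4.2 Thm 6(i) (arXiv:2306.16400 chunk p0009 L76–78)] -/
theorem numQubits_eq_of_equiv (φ : Mono ℓ m ≃+ Mono ℓ' m') : numQubits ℓ m = numQubits ℓ' m' := by
  unfold numQubits
  exact Fintype.card_congr (Equiv.sumCongr φ.toEquiv φ.toEquiv)

end Code

end BB

end Literature.InformationTheory.QuantumCodes
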